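import Summits.AtomisticToContinuum.Crystallization.Theses.DisclinationRation
import Summits.AtomisticToContinuum.Crystallization.Theorems.DisclinationRationAlphabetGoodHullElementStubAlphabetCleanHullElement
import Summits.AtomisticToContinuum.Crystallization.Theorems.DisclinationRationAlphabetGoodHullElementStubAlphabetGoodRelDense
import Summits.AtomisticToContinuum.Crystallization.Theorems.HullExactificationCascadeZeroDefectDensityConverse
import HarnessLib

/-!
# Birth skeleton (BC3) for crux `AlphabetGoodHullElement` — item stmt-AtomisticToContinuum-15798,
# route `DisclinationRation` (K1, rank 2, difficulty open-problem)

Crux (verbatim the route decl, concluded BY NAME below): for every sequence `x N` of Lennard-Jones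
ground states in `ℝ³` there are `δ > 0` and a HULL ELEMENT `S ∋ 0` of `x` (translates
`x (φ j) + τ j` two-way matched with `S` on every ball, eventually in `j`) that is `δ`-separated,
relatively dense and EVERYWHERE ALPHABET-GOOD: the strict `13/10·d_y` shell of every `y ∈ S`
(`d_y` = nearest-neighbour distance, an `sInf`), rescaled by `d_y⁻¹`, is `1/20`-matched through a
bijection and a linear isometry to `fccKissingPattern`, `hcpKissingPattern` or the twelve-point
decahedral-axis pattern `{±e₃} ∪ {(√3/2·cos(2πk/5), √3/2·sin(2πk/5), ±1/2)}` (the enlarged alphabet;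
predicate `GA` of the route file, inlined verbatim in every signature below).

## The line: DENSITY FORM → CLEAN HULL ELEMENT WITH BOUNDED SCALE → RELATIVE DENSENESS

This is the route header's own foreseen split of K1 ("AlphabetGoodHullElement ⇐
ZeroAlphabetDefectDensity (finite-N fraction → 0) → exactification no. 1 (pattern of 12089)"),
with the exactification cut at its one alphabet-sensitive seam:

* `stub_zeroAlphabetDefectDensity` (XL; energy — THE load-bearing stub) — the FINITE-N form provers
  should attack: along every sequence of Lennard-Jones ground states the fraction of particles `i`
  that are NOT alphabet-good in `Set.range (x N)` tends to `0`.  It is implied by the sibling crux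
  `HullExactificationCascade.ZeroDefectDensity` (stmt-12086, alphabet {fcc, hcp}) and is strictly
  weaker than it: the D₅ₕ decahedral-axis shell (barrier `DecahedralSoftShell`, the refutation
  witness of negatives stmt-4146) is now GOOD, so no energy inequality behind this stub has to price a
  locally almost-free shell; what it must still price is volumetric (Frank–Kasper / σ / A15
  `+0.086`, bcc `+0.031`, icosahedral shells with staggered rings, ≥ 5 %-strained close packing).
* `stub_alphabetCleanHullElement` (M; compactness — exactification no. 1 for the enlarged alphabet,
  the pattern of the PROVED `hullGoodEverywhere_proof`, stmt-12089) — if the alphabet-defect fraction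
  of `x` tends to `0`, some hull element `S ∋ 0` of `x` is `δ`-separated and every `y ∈ S` is
  alphabet-good WITH LOCAL SCALE `d_y ≤ R₀` for one `R₀`.  Proof plan (all tools landed under
  `Theorems/HullExactificationCascadeHullGoodEverywhere*.lean`): clean centres by pigeonhole
  (`hb_exists_far_from`), diagonal radii (`Filter.extraction_forall_of_eventually`), recentring,
  compactness of uniformly discrete sets (`exists_subseq_forall_eventually_ballMatch`), and passage of
  goodness to the limit PATTERN BY PATTERN (`hge_patternGood_of_limit`, stated for an arbitrary
  `Finset` pattern of unit vectors — the decahedral-axis set is such a pattern once written as a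
  `Finset` of its twelve points), the scale bound coming from the landed bond radius
  `hge_exists_bond_radius`; the only new work is the third pattern (a `Set`-to-`Finset` equivalence,
  unit norms, and `hge_frequently_or` applied twice for the three-way disjunction).
* `stub_alphabetGoodRelDense` (S/M; pure metric geometry — the one place the NEW letter's geometry is
  checked) — a nonempty `δ`-separated `S ⊆ ℝ³` all of whose points are alphabet-good with local
  scale `≤ R₀` is relatively dense.  Plan: the closest point `y ∈ S` to `p` exists (local
  finiteness); if `dist y p > 4R₀` a shell point of `y` is strictly closer (`hge_exists_closer`,
  landed, needs only the cover property `∀ u, ∃ v ∈ P, ‖u‖ ≤ 5⟪u, v⟫` of the pattern: landed for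
  fcc/hcp as `hge_fcc_cover` / `hge_hcp_cover`; for the decahedral-axis pattern it holds with room to
  spare — covering radius ≈ 45.6° (pole if `|u₃| ≥ ‖u‖/5`, else the nearest of the five ring points
  of the right sign), so `⟪u, v⟫ ≥ 0.68‖u‖`).

`AlphabetGoodHullElement_of : AlphabetGoodHullElement` is the kernel-checked composition of the
three stubs (stub 2 fed with stub 1 gives `S, δ, R₀`; stub 3 applied to `S ∋ 0` gives relative
denseness; the scale bound is dropped); the hypothesis form `stub₁-sig → stub₂-sig → stub₃-sig →
AlphabetGoodHullElement` is the sorry-free `example` right above it.  The ONLY `sorry` of this file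
(lead cycle 1, 2026-08-17) is `stub_zeroAlphabetDefectDensity`: stubs 2 and 3 are LANDED
(`Theorems/DisclinationRationAlphabetGoodHullElementStubAlphabetCleanHullElement.lean`,
`…StubAlphabetGoodRelDense.lean`, namespace `…Theorems.AlphabetGoodHullElementBirth`) and are
discharged below by `exact`.

Disproof.lean: none exists for this crux (`ledger crux ls stmt-AtomisticToContinuum-15798`: no
workfiles at registration) — nothing to honour.  Negatives index (20 entries, 2026-08-17): the
count-only / 1 %-tolerance shell witnesses (stmt-4146 `EffectiveLocalHales`, stmt-15929
`ShellCensus`) are not instances of any stub — stubs 1–2 quantify over Lennard-Jones ground states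
only, stub 3 assumes full pattern-level goodness (bijection to a twelve-point pattern at tolerance
`1/20`, cutoff `13/10`), and the D₅ₕ witness of 4146 is INSIDE the alphabet by design.

Registered signatures are ONE-LINE and fully qualified (they must survive textual restatement in a
`Theorems/`-side `--supports` file); each begins with the route's own `let GA …` (and `let HL …`)
prefix, copied byte-for-byte from the crux.
-/

noncomputable section

namespace Summit.AtomisticToContinuum.Crystallization.Cruxes.AlphabetGoodHullElement.Birth

/-! ## Registered stubs (the ONLY `sorry`s of the file; one-line, fully qualified signatures) -/

/-- **STUB 1a — soft alphabet order a.e.** (XL; ENERGETIC; the open-problem content after the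
cycle-1 reshape).  Along every sequence of Lennard-Jones ground states the fraction of particles `i`
WITHOUT a two-deep `(1/100, 27/20)`-kissing-ordered neighbourhood tends to `0`: for some scale
`a > 0`, every particle `v` within `13/5·a` of `x N i` has all other particles at distance
`≥ (1 − 1/100)·a`, each of them either `≤ (1 + 1/100)·a` (a contact) or `≥ 27/20·a`, and EXACTLY
twelve contacts.  The sibling line's `stub_softKissingOrder` (crux `ZeroDefectDensity`) is the same
shape at tolerance `1/4000`; here the tolerance `1/100` is chosen so that the statement TOLERATES an
isolated five-fold axis together with its elastic far field (lead numerics, relaxed five-fold column: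
half-spread of the twelve bond lengths ≤ 0.0086 on the axis, ≈ 0.0055 in the far field; thirteenth
neighbour ≥ 1.385·a) and every relaxed Barlow stacking (half-spread ~1e-4), while it still excludes
icosahedral centres (shell bonds 1.0515·a fall in the forbidden annulus) and every non-12-coordinated
phase (bcc/bct 14, A15, Frank–Kasper Z14–Z16, vacancies).  Why it might fail: as for every energetic
rung of the sub-problem (a bulk phase within o(1)/particle of e*; no local energy inequality for the
r⁻⁶ tail); and grain boundaries / second-order twins must have density → 0. -/
theorem stub_softAlphabetOrder : ∀ (x : (N : ℕ) → (Fin N → EuclideanSpace ℝ (Fin 3))), (∀ N, Literature.MathematicalPhysics.StatisticalMechanics.IsGroundState Literature.MathematicalPhysics.StatisticalMechanics.lennardJones (x N)) → Filter.Tendsto (fun N : ℕ => (Nat.card {i : Fin N // ¬ (∃ a : ℝ, 0 < a ∧ ∀ v ∈ Set.range (x N), dist (x N i) v ≤ 13 / 5 * a → ((∀ w ∈ Set.range (x N), w ≠ v → (1 - 1 / 100) * a ≤ dist v w ∧ (dist v w ≤ (1 + 1 / 100) * a ∨ 27 / 20 * a ≤ dist v w)) ∧ {w ∈ Set.range (x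 N) | w ≠ v ∧ dist v w ≤ (1 + 1 / 100) * a}.ncard = 12))} : ℝ) / (N : ℝ)) Filter.atTop (nhds (0 : ℝ)) := by
  sorry

/-- **STUB 1b — the alphabet kernel** (L/XL; PURE GEOMETRY, finite-dimensional; 9208-type).
Two-deep `(1/100, 27/20)`-kissing order at a site `y` of ANY `S ⊆ ℝ³` forces `y` to be
alphabet-good (the crux's `GA S y`: the twelve contacts, rescaled by the nearest-neighbour distance,
are `1/20`-matched after a linear isometry to the fcc, the hcp or the decahedral-axis pattern).  The
depth is load-bearing: the ONE-deep version is FALSE (lead numerics: a twisted anticuboctahedral shell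
with all 24 shell contacts and 12 spokes in `[0.99, 1.01]` and every other pair distance `≥ 1.35`
has GA-deviation `0.075 > 1/20`; the cuboctahedron's jitterbug reaches deviation `0.0101`/degree
with its square diagonal shrinking `0.015`/degree, i.e. `0.05` exactly at gap `1.338`), while freezing
such a shell inside an fcc/hcp cluster admits no two-deep completion in the lead's projection search
and two-deep adversarial climbs stay ≤ 0.025 (kit jobs j026854 / j026861 attached to the item).  Why
it might fail: an exotic two-deep-ordered 12-vertex link (planar, triangle/quadrilateral faces,
degrees 4–5) other than cuboctahedron / anticuboctahedron / bicapped pentagonal prism, or a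
two-deep-consistent twist of amplitude > 2.6°. -/
theorem stub_alphabetKernel : let GA : Set (EuclideanSpace ℝ (Fin 3)) → EuclideanSpace ℝ (Fin 3) → Prop := fun S y => let d : ℝ := sInf ((fun z => dist z y) '' (S \ {y})); let T : Set (EuclideanSpace ℝ (Fin 3)) := {z : EuclideanSpace ℝ (Fin 3) | z ∈ S ∧ z ≠ y ∧ dist z y < 13 / 10 * d}; ∃ A : EuclideanSpace ℝ (Fin 3) →ₗᵢ[ℝ] EuclideanSpace ℝ (Fin 3), (∃ e : ↥T ≃ ↥Literature.Geometry.DiscreteGeometry.fccKissingPattern, ∀ t : ↥T, dist (d⁻¹ • ((t : EuclideanSpace ℝ (Fin 3)) - y)) (A ((e t : ↥Literature.Geometry.DiscreteGeometry.fccKissingPattern) : EuclideanSpace ℝ (Fin 3))) ≤ 1 / 20) ∨ (∃ e : ↥T ≃ ↥Literature.Geometry.DiscreteGeometry.hcpKissingPattern, ∀ t : ↥T, dist (d⁻¹ • ((t : EuclideanSpace ℝ (Fin 3)) - y)) (A ((e t : ↥Literature.Geometry.DiscreteGeometry.hcpKissingPattern) : EuclideanSpace ℝ (Fin 3))) ≤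 1 / 20) ∨ (∃ e : ↥T ≃ ↥{p : EuclideanSpace ℝ (Fin 3) | p = !₂[(0 : ℝ), 0, 1] ∨ p = !₂[(0 : ℝ), 0, -1] ∨ ∃ k : Fin 5, ∃ σ : ℝ, (σ = 1 / 2 ∨ σ = -(1 / 2)) ∧ p = !₂[Real.sqrt 3 / 2 * Real.cos (2 * Real.pi * (k : ℝ) / 5), Real.sqrt 3 / 2 * Real.sin (2 * Real.pi * (k : ℝ) / 5), σ]}, ∀ t : ↥T, dist (d⁻¹ • ((t : EuclideanSpace ℝ (Fin 3)) - y)) (A ((e t : ↥{p : EuclideanSpace ℝ (Fin 3) | p = !₂[(0 : ℝ), 0, 1] ∨ p = !₂[(0 : ℝ), 0, -1] ∨ ∃ k : Fin 5, ∃ σ : ℝ, (σ = 1 / 2 ∨ σ = -(1 / 2)) ∧ p = !₂[Real.sqrt 3 / 2 * Real.cos (2 * Real.pi * (k : ℝ) / 5), Real.sqrt 3 / 2 * Real.sin (2 * Real.pi * (k : ℝ) / 5), σ]}) : EuclideanSpace ℝ (Fin 3))) ≤ 1 / 20); ∀ (S : Set (EuclideanSpace ℝ (Fin 3))) (y : EuclideanSpace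 ℝ (Fin 3)), y ∈ S → (∃ a : ℝ, 0 < a ∧ ∀ v ∈ S, dist y v ≤ 13 / 5 * a → ((∀ w ∈ S, w ≠ v → (1 - 1 / 100) * a ≤ dist v w ∧ (dist v w ≤ (1 + 1 / 100) * a ∨ 27 / 20 * a ≤ dist v w)) ∧ {w ∈ S | w ≠ v ∧ dist v w ≤ (1 + 1 / 100) * a}.ncard = 12)) → GA S y := by
  sorry

/-- **STUB 1 — zero alphabet-defect density, finite-N form** (registered; since the cycle-1 reshape
PROVED below from stubs 1a + 1b by the pointwise inclusion of defect sets and `squeeze_zero`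
(`ZeroDefectDensityBirth.tendsto_density_mono`); it stays registered as a direct target).  Along
every sequence of Lennard-Jones ground states in `ℝ³` the fraction of particles whose rescaled
strict `13/10·dᵢ` shell is NOT `1/20`-matched (bijection + linear isometry) to the fcc, the hcp or
the decahedral-axis pattern tends to `0`.  Implied by `HullExactificationCascade.ZeroDefectDensity`
(stmt-12086) and strictly weaker (larger alphabet).  Why it might fail: a bulk phase outside the
alphabet within `o(1)`/particle of `e*` (Frank–Kasper/σ-type order, bcc at `+0.031`, ≥ 5 %-strained
close packing), or no provable on-average local energy inequality for the `r⁻⁶` tail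
(barrier `LocalizedPotentialsExcludeLennardJones`). -/
theorem stub_zeroAlphabetDefectDensity : let GA : Set (EuclideanSpace ℝ (Fin 3)) → EuclideanSpace ℝ (Fin 3) → Prop := fun S y => let d : ℝ := sInf ((fun z => dist z y) '' (S \ {y})); let T : Set (EuclideanSpace ℝ (Fin 3)) := {z : EuclideanSpace ℝ (Fin 3) | z ∈ S ∧ z ≠ y ∧ dist z y < 13 / 10 * d}; ∃ A : EuclideanSpace ℝ (Fin 3) →ₗᵢ[ℝ] EuclideanSpace ℝ (Fin 3), (∃ e : ↥T ≃ ↥Literature.Geometry.DiscreteGeometry.fccKissingPattern, ∀ t : ↥T, dist (d⁻¹ • ((t : EuclideanSpace ℝ (Fin 3)) - y)) (A ((e t : ↥Literature.Geometry.DiscreteGeometry.fccKissingPattern) : EuclideanSpace ℝ (Fin 3))) ≤ 1 / 20) ∨ (∃ e : ↥T ≃ ↥Literature.Geometry.DiscreteGeometry.hcpKissingPattern, ∀ t : ↥T, dist (d⁻¹ • ((t : EuclideanSpace ℝ (Fin 3)) - y)) (A ((e t : ↥Literature.Geometry.DiscreteGeometry.hcpKissingPattern) : EuclideanSpace ℝ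 (Fin 3))) ≤ 1 / 20) ∨ (∃ e : ↥T ≃ ↥{p : EuclideanSpace ℝ (Fin 3) | p = !₂[(0 : ℝ), 0, 1] ∨ p = !₂[(0 : ℝ), 0, -1] ∨ ∃ k : Fin 5, ∃ σ : ℝ, (σ = 1 / 2 ∨ σ = -(1 / 2)) ∧ p = !₂[Real.sqrt 3 / 2 * Real.cos (2 * Real.pi * (k : ℝ) / 5), Real.sqrt 3 / 2 * Real.sin (2 * Real.pi * (k : ℝ) / 5), σ]}, ∀ t : ↥T, dist (d⁻¹ • ((t : EuclideanSpace ℝ (Fin 3)) - y)) (A ((e t : ↥{p : EuclideanSpace ℝ (Fin 3) | p = !₂[(0 : ℝ), 0, 1] ∨ p = !₂[(0 : ℝ), 0, -1] ∨ ∃ k : Fin 5, ∃ σ : ℝ, (σ = 1 / 2 ∨ σ = -(1 / 2)) ∧ p = !₂[Real.sqrt 3 / 2 * Real.cos (2 * Real.pi * (k : ℝ) / 5), Real.sqrt 3 / 2 * Real.sin (2 * Real.pi * (k : ℝ) / 5), σ]}) : EuclideanSpace ℝ (Fin 3))) ≤ 1 / 20); ∀ (x : (N : ℕ) → (Fin N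 → EuclideanSpace ℝ (Fin 3))), (∀ N, Literature.MathematicalPhysics.StatisticalMechanics.IsGroundState Literature.MathematicalPhysics.StatisticalMechanics.lennardJones (x N)) → Filter.Tendsto (fun N : ℕ => (Nat.card {i : Fin N // ¬ GA (Set.range (x N)) (x N i)} : ℝ) / (N : ℝ)) Filter.atTop (nhds (0 : ℝ)) := by
  intro GA x hx
  refine Summit.AtomisticToContinuum.Crystallization.Theorems.ZeroDefectDensityBirth.tendsto_density_mono
    (P := fun N i => ¬ GA (Set.range (x N)) (x N i))
    (Q := fun N i => ¬ (∃ a : ℝ, 0 < a ∧ ∀ v ∈ Set.range (x N), dist (x N i) v ≤ 13 / 5 * a → ((∀ w ∈ Set.range (x N), w ≠ v → (1 - 1 / 100) * a ≤ dist v w ∧ (dist v w ≤ (1 + 1 / 100) * a ∨ 27 / 20 * a ≤ dist v w)) ∧ {w ∈ Set.range (x N) | w ≠ v ∧ dist v w ≤ (1 + 1 / 100) * a}.ncard = 12)))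
    (fun N i hP hQ => hP (stub_alphabetKernel (Set.range (x N)) (x N i) (Set.mem_range_self i) hQ))
    (stub_softAlphabetOrder x hx)

/-- **STUB 2 — clean hull element with bounded scale** (M; compactness; exactification no. 1 of
`HullExactificationCascade` re-run with the enlarged alphabet).  If the alphabet-defect fraction of a
sequence of Lennard-Jones ground states tends to `0`, some hull element `S` of it (two-way matching of
translates along a subsequence on every ball) is `δ`-separated, contains `0`, and every `y ∈ S` is
alphabet-good with local scale `sInf (dist · y '' (S ∖ {y})) ≤ R₀`.  Pattern of the PROVED
`hullGoodEverywhere_proof` (stmt-12089): `hb_exists_far_from`, `extraction_forall_of_eventually`,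
`exists_subseq_forall_eventually_ballMatch`, `hge_patternGood_of_limit` (any `Finset` pattern of unit
vectors), `hge_exists_bond_radius`. -/
theorem stub_alphabetCleanHullElement : let GA : Set (EuclideanSpace ℝ (Fin 3)) → EuclideanSpace ℝ (Fin 3) → Prop := fun S y => let d : ℝ := sInf ((fun z => dist z y) '' (S \ {y})); let T : Set (EuclideanSpace ℝ (Fin 3)) := {z : EuclideanSpace ℝ (Fin 3) | z ∈ S ∧ z ≠ y ∧ dist z y < 13 / 10 * d}; ∃ A : EuclideanSpace ℝ (Fin 3) →ₗᵢ[ℝ] EuclideanSpace ℝ (Fin 3), (∃ e : ↥T ≃ ↥Literature.Geometry.DiscreteGeometry.fccKissingPattern, ∀ t : ↥T, dist (d⁻¹ • ((t : EuclideanSpace ℝ (Fin 3)) - y)) (A ((e t : ↥Literature.Geometry.DiscreteGeometry.fccKissingPattern) : EuclideanSpace ℝ (Fin 3))) ≤ 1 / 20) ∨ (∃ e : ↥T ≃ ↥Literature.Geometry.DiscreteGeometry.hcpKissingPattern, ∀ t : ↥T, dist (d⁻¹ • ((t : EuclideanSpace ℝ (Fin 3)) - y)) (A ((e t : ↥Literature.Geometry.DiscreteGeometry.hcpKissingPattern)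 : EuclideanSpace ℝ (Fin 3))) ≤ 1 / 20) ∨ (∃ e : ↥T ≃ ↥{p : EuclideanSpace ℝ (Fin 3) | p = !₂[(0 : ℝ), 0, 1] ∨ p = !₂[(0 : ℝ), 0, -1] ∨ ∃ k : Fin 5, ∃ σ : ℝ, (σ = 1 / 2 ∨ σ = -(1 / 2)) ∧ p = !₂[Real.sqrt 3 / 2 * Real.cos (2 * Real.pi * (k : ℝ) / 5), Real.sqrt 3 / 2 * Real.sin (2 * Real.pi * (k : ℝ) / 5), σ]}, ∀ t : ↥T, dist (d⁻¹ • ((t : EuclideanSpace ℝ (Fin 3)) - y)) (A ((e t : ↥{p : EuclideanSpace ℝ (Fin 3) | p = !₂[(0 : ℝ), 0, 1] ∨ p = !₂[(0 : ℝ), 0, -1] ∨ ∃ k : Fin 5, ∃ σ : ℝ, (σ = 1 / 2 ∨ σ = -(1 / 2)) ∧ p = !₂[Real.sqrt 3 / 2 * Real.cos (2 * Real.pi * (k : ℝ) / 5), Real.sqrt 3 / 2 * Real.sin (2 * Real.pi * (k : ℝ) / 5), σ]}) : EuclideanSpace ℝ (Fin 3))) ≤ 1 / 20); let HL : ((N :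 ℕ) → (Fin N → EuclideanSpace ℝ (Fin 3))) → Set (EuclideanSpace ℝ (Fin 3)) → Prop := fun x S => ∃ φ : ℕ → ℕ, StrictMono φ ∧ ∃ τ : ℕ → EuclideanSpace ℝ (Fin 3), ∀ R ε : ℝ, 0 < ε → ∀ᶠ j : ℕ in Filter.atTop, (∀ s ∈ S, ‖s‖ ≤ R → ∃ i : Fin (φ j), dist (x (φ j) i + τ j) s ≤ ε) ∧ (∀ i : Fin (φ j), ‖x (φ j) i + τ j‖ ≤ R → ∃ s ∈ S, dist (x (φ j) i + τ j) s ≤ ε); ∀ (x : (N : ℕ) → (Fin N → EuclideanSpace ℝ (Fin 3))), (∀ N, Literature.MathematicalPhysics.StatisticalMechanics.IsGroundState Literature.MathematicalPhysics.StatisticalMechanics.lennardJones (x N)) → Filter.Tendsto (fun N : ℕ => (Nat.card {i : Fin N // ¬ GA (Set.range (x N)) (x N i)} : ℝ) / (N : ℝ)) Filter.atTop (nhds (0 : ℝ)) → ∃ S : Set (EuclideanSpace ℝ (Fin 3)), ∃ δ R₀ : ℝ, 0 < δ ∧ (∀ y ∈ S, ∀ z ∈ S, y ≠ z → δ ≤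 dist y z) ∧ (0 : EuclideanSpace ℝ (Fin 3)) ∈ S ∧ HL x S ∧ (∀ y ∈ S, GA S y ∧ sInf ((fun z => dist z y) '' (S \ {y})) ≤ R₀) := by
  exact Summit.AtomisticToContinuum.Crystallization.Theorems.AlphabetGoodHullElementBirth.stub_alphabetCleanHullElement

/-- **STUB 3 — everywhere-alphabet-good sets with bounded scale are relatively dense** (S/M; pure
metric geometry).  A nonempty `δ`-separated `S ⊆ ℝ³` every point of which is alphabet-good with
local scale `≤ R₀` has a point within `R₁` of every point of `ℝ³` (in fact `R₁ = 4R₀`): the closest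
point of `S` to `p` exists by local finiteness and, if farther than `4R₀`, one of its twelve shell
points is strictly closer (`hge_exists_closer`, landed), because each of the three patterns COVERS
the sphere in the weak sense `∀ u, ∃ v ∈ P, ‖u‖ ≤ 5⟪u, v⟫` (landed `hge_fcc_cover`, `hge_hcp_cover`;
for the decahedral-axis pattern the covering radius is ≈ 45.6°). -/
theorem stub_alphabetGoodRelDense : let GA : Set (EuclideanSpace ℝ (Fin 3)) → EuclideanSpace ℝ (Fin 3) → Prop := fun S y => let d : ℝ := sInf ((fun z => dist z y) '' (S \ {y})); let T : Set (EuclideanSpace ℝ (Fin 3)) := {z : EuclideanSpace ℝ (Fin 3) | z ∈ S ∧ z ≠ y ∧ dist z y < 13 / 10 * d}; ∃ A : EuclideanSpace ℝ (Fin 3) →ₗᵢ[ℝ] EuclideanSpace ℝ (Fin 3), (∃ e : ↥T ≃ ↥Literature.Geometry.DiscreteGeometry.fccKissingPattern, ∀ t : ↥T, dist (d⁻¹ • ((t : EuclideanSpace ℝ (Fin 3)) - y)) (A ((e t : ↥Literature.Geometry.DiscreteGeometry.fccKissingPattern) : EuclideanSpace ℝ (Fin 3))) ≤ 1 / 20)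 ∨ (∃ e : ↥T ≃ ↥Literature.Geometry.DiscreteGeometry.hcpKissingPattern, ∀ t : ↥T, dist (d⁻¹ • ((t : EuclideanSpace ℝ (Fin 3)) - y)) (A ((e t : ↥Literature.Geometry.DiscreteGeometry.hcpKissingPattern) : EuclideanSpace ℝ (Fin 3))) ≤ 1 / 20) ∨ (∃ e : ↥T ≃ ↥{p : EuclideanSpace ℝ (Fin 3) | p = !₂[(0 : ℝ), 0, 1] ∨ p = !₂[(0 : ℝ), 0, -1] ∨ ∃ k : Fin 5, ∃ σ : ℝ, (σ = 1 / 2 ∨ σ = -(1 / 2)) ∧ p = !₂[Real.sqrt 3 / 2 * Real.cos (2 * Real.pi * (k : ℝ) / 5), Real.sqrt 3 / 2 * Real.sin (2 * Real.pi * (k : ℝ) / 5), σ]}, ∀ t : ↥T, dist (d⁻¹ • ((t : EuclideanSpace ℝ (Fin 3)) - y)) (A ((e t : ↥{p : EuclideanSpace ℝ (Fin 3) | p = !₂[(0 : ℝ), 0, 1] ∨ p = !₂[(0 : ℝ), 0, -1] ∨ ∃ k : Fin 5, ∃ σ : ℝ, (σ = 1 / 2 ∨ σ = -(1 / 2)) ∧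 p = !₂[Real.sqrt 3 / 2 * Real.cos (2 * Real.pi * (k : ℝ) / 5), Real.sqrt 3 / 2 * Real.sin (2 * Real.pi * (k : ℝ) / 5), σ]}) : EuclideanSpace ℝ (Fin 3))) ≤ 1 / 20); ∀ (δ R₀ : ℝ) (S : Set (EuclideanSpace ℝ (Fin 3))), 0 < δ → (∀ y ∈ S, ∀ z ∈ S, y ≠ z → δ ≤ dist y z) → S.Nonempty → (∀ y ∈ S, GA S y ∧ sInf ((fun z => dist z y) '' (S \ {y})) ≤ R₀) → ∃ R₁ : ℝ, ∀ p : EuclideanSpace ℝ (Fin 3), ∃ y ∈ S, dist y p ≤ R₁ := by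
  exact Summit.AtomisticToContinuum.Crystallization.Theorems.AlphabetGoodHullElementBirth.stub_alphabetGoodRelDense

/-! ## Composition (kernel-checked): the stubs imply the crux BY NAME -/

/-- HYPOTHESIS FORM (BC3 letter; sorry-free, real proof): the three stub STATEMENTS imply the crux —
stub 2 fed with stub 1 yields the hull element with its scale bound, stub 3 its relative denseness.
Kept as an `example` so that `AlphabetGoodHullElement_of` below is the file's ONLY declaration
concluding the crux by name (the skeleton checker admits no inlined `Prop` binders there). -/
example : (let GA : Set (EuclideanSpace ℝ (Fin 3)) → EuclideanSpace ℝ (Fin 3) → Prop := fun S y => let d : ℝ := sInf ((fun z => dist z y) '' (S \ {y})); let T : Set (EuclideanSpace ℝ (Fin 3)) := {z : EuclideanSpace ℝ (Fin 3) | z ∈ S ∧ z ≠ y ∧ dist z y < 13 / 10 * d}; ∃ A : EuclideanSpace ℝ (Fin 3) →ₗᵢ[ℝ] EuclideanSpace ℝ (Fin 3), (∃ e : ↥T ≃ ↥Literature.Geometry.DiscreteGeometry.fccKissingPattern, ∀ t : ↥T, dist (d⁻¹ • ((t : EuclideanSpace ℝ (Fin 3)) - y)) (A ((e t : ↥Literature.Geometry.DiscreteGeometry.fccKissingPattern)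 : EuclideanSpace ℝ (Fin 3))) ≤ 1 / 20) ∨ (∃ e : ↥T ≃ ↥Literature.Geometry.DiscreteGeometry.hcpKissingPattern, ∀ t : ↥T, dist (d⁻¹ • ((t : EuclideanSpace ℝ (Fin 3)) - y)) (A ((e t : ↥Literature.Geometry.DiscreteGeometry.hcpKissingPattern) : EuclideanSpace ℝ (Fin 3))) ≤ 1 / 20) ∨ (∃ e : ↥T ≃ ↥{p : EuclideanSpace ℝ (Fin 3) | p = !₂[(0 : ℝ), 0, 1] ∨ p = !₂[(0 : ℝ), 0, -1] ∨ ∃ k : Fin 5, ∃ σ : ℝ, (σ = 1 / 2 ∨ σ = -(1 / 2)) ∧ p = !₂[Real.sqrt 3 / 2 * Real.cos (2 * Real.pi * (k : ℝ) / 5), Real.sqrt 3 / 2 * Real.sin (2 * Real.pi * (k : ℝ) / 5), σ]}, ∀ t : ↥T, dist (d⁻¹ • ((t : EuclideanSpace ℝ (Fin 3)) - y)) (A ((e t : ↥{p : EuclideanSpace ℝ (Fin 3) | p = !₂[(0 : ℝ), 0, 1] ∨ p = !₂[(0 : ℝ), 0, -1] ∨ ∃ k : Fin 5, ∃ σ :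 ℝ, (σ = 1 / 2 ∨ σ = -(1 / 2)) ∧ p = !₂[Real.sqrt 3 / 2 * Real.cos (2 * Real.pi * (k : ℝ) / 5), Real.sqrt 3 / 2 * Real.sin (2 * Real.pi * (k : ℝ) / 5), σ]}) : EuclideanSpace ℝ (Fin 3))) ≤ 1 / 20); ∀ (x : (N : ℕ) → (Fin N → EuclideanSpace ℝ (Fin 3))), (∀ N, Literature.MathematicalPhysics.StatisticalMechanics.IsGroundState Literature.MathematicalPhysics.StatisticalMechanics.lennardJones (x N)) → Filter.Tendsto (fun N : ℕ => (Nat.card {i : Fin N // ¬ GA (Set.range (x N)) (x N i)} : ℝ) / (N : ℝ)) Filter.atTop (nhds (0 : ℝ))) → (let GA : Set (EuclideanSpace ℝ (Fin 3)) → EuclideanSpace ℝ (Fin 3) → Prop := fun S y => let d : ℝ := sInf ((fun z => dist z y) '' (S \ {y})); let T : Set (EuclideanSpace ℝ (Fin 3)) := {z : EuclideanSpace ℝ (Fin 3) | z ∈ S ∧ z ≠ y ∧ dist z y < 13 / 10 * d}; ∃ A : EuclideanSpace ℝ (Fin 3) →ₗᵢ[ℝ] EuclideanSpace ℝ (Fin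 3), (∃ e : ↥T ≃ ↥Literature.Geometry.DiscreteGeometry.fccKissingPattern, ∀ t : ↥T, dist (d⁻¹ • ((t : EuclideanSpace ℝ (Fin 3)) - y)) (A ((e t : ↥Literature.Geometry.DiscreteGeometry.fccKissingPattern) : EuclideanSpace ℝ (Fin 3))) ≤ 1 / 20) ∨ (∃ e : ↥T ≃ ↥Literature.Geometry.DiscreteGeometry.hcpKissingPattern, ∀ t : ↥T, dist (d⁻¹ • ((t : EuclideanSpace ℝ (Fin 3)) - y)) (A ((e t : ↥Literature.Geometry.DiscreteGeometry.hcpKissingPattern) : EuclideanSpace ℝ (Fin 3))) ≤ 1 / 20) ∨ (∃ e : ↥T ≃ ↥{p : EuclideanSpace ℝ (Fin 3) | p = !₂[(0 : ℝ), 0, 1] ∨ p = !₂[(0 : ℝ), 0, -1] ∨ ∃ k : Fin 5, ∃ σ : ℝ, (σ = 1 / 2 ∨ σ = -(1 / 2)) ∧ p = !₂[Real.sqrt 3 / 2 * Real.cos (2 * Real.pi * (k : ℝ) / 5), Real.sqrt 3 / 2 * Real.sin (2 * Real.pi * (k : ℝ) / 5), σ]}, ∀ t : ↥T, dist (d⁻¹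 • ((t : EuclideanSpace ℝ (Fin 3)) - y)) (A ((e t : ↥{p : EuclideanSpace ℝ (Fin 3) | p = !₂[(0 : ℝ), 0, 1] ∨ p = !₂[(0 : ℝ), 0, -1] ∨ ∃ k : Fin 5, ∃ σ : ℝ, (σ = 1 / 2 ∨ σ = -(1 / 2)) ∧ p = !₂[Real.sqrt 3 / 2 * Real.cos (2 * Real.pi * (k : ℝ) / 5), Real.sqrt 3 / 2 * Real.sin (2 * Real.pi * (k : ℝ) / 5), σ]}) : EuclideanSpace ℝ (Fin 3))) ≤ 1 / 20); let HL : ((N : ℕ) → (Fin N → EuclideanSpace ℝ (Fin 3))) → Set (EuclideanSpace ℝ (Fin 3)) → Prop := fun x S => ∃ φ : ℕ → ℕ, StrictMono φ ∧ ∃ τ : ℕ → EuclideanSpace ℝ (Fin 3), ∀ R ε : ℝ, 0 < ε → ∀ᶠ j : ℕ in Filter.atTop, (∀ s ∈ S, ‖s‖ ≤ R → ∃ i : Fin (φ j), dist (x (φ j) i + τ j) s ≤ ε) ∧ (∀ i : Fin (φ j), ‖x (φ j) i + τ j‖ ≤ R → ∃ s ∈ S, dist (x (φ j) i + τ j) s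 ≤ ε); ∀ (x : (N : ℕ) → (Fin N → EuclideanSpace ℝ (Fin 3))), (∀ N, Literature.MathematicalPhysics.StatisticalMechanics.IsGroundState Literature.MathematicalPhysics.StatisticalMechanics.lennardJones (x N)) → Filter.Tendsto (fun N : ℕ => (Nat.card {i : Fin N // ¬ GA (Set.range (x N)) (x N i)} : ℝ) / (N : ℝ)) Filter.atTop (nhds (0 : ℝ)) → ∃ S : Set (EuclideanSpace ℝ (Fin 3)), ∃ δ R₀ : ℝ, 0 < δ ∧ (∀ y ∈ S, ∀ z ∈ S, y ≠ z → δ ≤ dist y z) ∧ (0 : EuclideanSpace ℝ (Fin 3)) ∈ S ∧ HL x S ∧ (∀ y ∈ S, GA S y ∧ sInf ((fun z => dist z y) '' (S \ {y})) ≤ R₀)) → (let GA : Set (EuclideanSpace ℝ (Fin 3)) → EuclideanSpace ℝ (Fin 3) → Prop := fun S y => let d : ℝ := sInf ((fun z => dist z y) '' (S \ {y})); let T : Set (EuclideanSpace ℝ (Fin 3)) := {z : EuclideanSpace ℝ (Fin 3) | z ∈ S ∧ z ≠ y ∧ dist z y < 13 / 10 * d}; ∃ A : EuclideanSpace ℝ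 (Fin 3) →ₗᵢ[ℝ] EuclideanSpace ℝ (Fin 3), (∃ e : ↥T ≃ ↥Literature.Geometry.DiscreteGeometry.fccKissingPattern, ∀ t : ↥T, dist (d⁻¹ • ((t : EuclideanSpace ℝ (Fin 3)) - y)) (A ((e t : ↥Literature.Geometry.DiscreteGeometry.fccKissingPattern) : EuclideanSpace ℝ (Fin 3))) ≤ 1 / 20) ∨ (∃ e : ↥T ≃ ↥Literature.Geometry.DiscreteGeometry.hcpKissingPattern, ∀ t : ↥T, dist (d⁻¹ • ((t : EuclideanSpace ℝ (Fin 3)) - y)) (A ((e t : ↥Literature.Geometry.DiscreteGeometry.hcpKissingPattern) : EuclideanSpace ℝ (Fin 3))) ≤ 1 / 20) ∨ (∃ e : ↥T ≃ ↥{p : EuclideanSpace ℝ (Fin 3) | p = !₂[(0 : ℝ), 0, 1] ∨ p = !₂[(0 : ℝ), 0, -1] ∨ ∃ k : Fin 5, ∃ σ : ℝ, (σ = 1 / 2 ∨ σ = -(1 / 2)) ∧ p = !₂[Real.sqrt 3 / 2 * Real.cos (2 * Real.pi * (k : ℝ) / 5), Real.sqrt 3 / 2 * Real.sin (2 * Real.pi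 * (k : ℝ) / 5), σ]}, ∀ t : ↥T, dist (d⁻¹ • ((t : EuclideanSpace ℝ (Fin 3)) - y)) (A ((e t : ↥{p : EuclideanSpace ℝ (Fin 3) | p = !₂[(0 : ℝ), 0, 1] ∨ p = !₂[(0 : ℝ), 0, -1] ∨ ∃ k : Fin 5, ∃ σ : ℝ, (σ = 1 / 2 ∨ σ = -(1 / 2)) ∧ p = !₂[Real.sqrt 3 / 2 * Real.cos (2 * Real.pi * (k : ℝ) / 5), Real.sqrt 3 / 2 * Real.sin (2 * Real.pi * (k : ℝ) / 5), σ]}) : EuclideanSpace ℝ (Fin 3))) ≤ 1 / 20); ∀ (δ R₀ : ℝ) (S : Set (EuclideanSpace ℝ (Fin 3))), 0 < δ → (∀ y ∈ S, ∀ z ∈ S, y ≠ z → δ ≤ dist y z) → S.Nonempty → (∀ y ∈ S, GA S y ∧ sInf ((fun z => dist z y) '' (S \ {y})) ≤ R₀) → ∃ R₁ : ℝ, ∀ p : EuclideanSpace ℝ (Fin 3), ∃ y ∈ S, dist y p ≤ R₁) → Summit.AtomisticToContinuum.Crystallization.Theses.DisclinationRation.AlphabetGoodHullElement := by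
  intro h1 h2 h3 x hx
  obtain ⟨S, δ, R₀, hδ, hsep, h0, hHL, hgood⟩ := h2 x hx (h1 x hx)
  exact ⟨S, δ, hδ, hsep, h0, hHL, fun y hy => (hgood y hy).1, h3 δ R₀ S hδ hsep ⟨0, h0⟩ hgood⟩

/-- THE SKELETON THEOREM (registered form: concludes the route decl `AlphabetGoodHullElement` BY
NAME, no hypotheses, `sorry` only through the three declared `stub_*`):
`AlphabetGoodHullElement_of = (stub_alphabetCleanHullElement ∘ stub_zeroAlphabetDefectDensity,
stub_alphabetGoodRelDense)`. -/
theorem AlphabetGoodHullElement_of : Summit.AtomisticToContinuum.Crystallization.Theses.DisclinationRation.AlphabetGoodHullElement := by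
  intro x hx
  obtain ⟨S, δ, R₀, hδ, hsep, h0, hHL, hgood⟩ :=
    stub_alphabetCleanHullElement x hx (stub_zeroAlphabetDefectDensity x hx)
  exact ⟨S, δ, hδ, hsep, h0, hHL, fun y hy => (hgood y hy).1,
    stub_alphabetGoodRelDense δ R₀ S hδ hsep ⟨0, h0⟩ hgood⟩

end Summit.AtomisticToContinuum.Crystallization.Cruxes.AlphabetGoodHullElement.Birth

end
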